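/-
Copyright: the b2b-balaban T⁴-continuum CRUX team, row NE7b OWNER lineage `t4-ne7b-p1` (gen 134). Project licence.
-/
import Summits.QuantumFields.BalabanUV.T4Continuum.Spine.NE7b.SupStepKPNormLinear

/-!
# CLOSING THE LOOP OF THE LETTERS: SUP LETTERS GIVE THE PINNED NORM, THE STEP IS LINEAR IN THE NORM, AND THE OUTPUT RE-MAYERISES IN THE SAME NORM —
# (i) an activity vanishing off the `R`-connected sets with `‖z Y‖ ≤ ε^{#Y}` (`R` symmetric, `≤ Δ` neighbours) has uniform pinned Kotecký–Preiss norm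
# `Σ_{Y∈L touching {q}}‖z Y‖e^{a#Y} ≤ 2(Δ+1)·εe^{a}` (`(Δ+1)²εe^{a} ≤ 1∕2`; the lattice-animal bound); (ii) hence with `a = 1+τ` and
# `η := 2(Δ+1)e^{1+τ}ε ≤ 1`, (356)'s linear step gives `Σ_{Y∋p}‖K⁺(Y)‖e^{τ#Y} ≤ η` and `Σ_{Y touching {q}}‖K⁺(Y)‖e^{τ#Y} ≤ (Δ+1)η` for the
# support terms of the regrouped output; (iii) THE RE-MAYERISATION: any family `K` of support terms with `Σ_{Y∈T touching {q}}‖K(Y)‖e^{a#Y} ≤ η ≤ 1`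
# (nonempty supports) has next Mayer factors `f⁺_Y := e^{K(Y)} − 1` with `Σ_{Y∈T touching {q}}‖f⁺_Y‖e^{a#Y} ≤ 2η` in the SAME norm, and
# `exp(Σ_{Y∈T}K(Y)) = ∏_{Y∈T}(1 + f⁺_Y)` — so the step's output `Z = exp(Σ_Y K⁺_Y)` IS a Mayer product over connected cell sets whose factors are
# measured in the input's own norm: letters in ↦ norm ↦ norm out ↦ letters of the next input, every arrow LINEAR (row NE7b, node U5c; (356) +
# the tree's `sum_pow_card_le_of_connected` + Mathlib's `Complex.norm_exp_sub_one_le` ∕ `Complex.exp_sum` BY NAME; [folklore])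

Cell `pub-balaban`, sub-cell `t4`, spine estimate NE7b (`T4WeightBudget.RelWeightBound`; the cell's OWN estimate — NOT PRINTED in
[Bałaban 1983–89], NOT PROVED).  Crux-route work under `Spine/NE7b/` by the row OWNER (`t4-ne7b-p1` gen 134, file (358)) under FREEZE
(0)'s crux-prover clause, on `g134/records/SCOPING-d6-iteration.md` DECISION (1)∕(2); NOTHING of Bałaban's is named as a Lean object, valued or
asserted; no `T4Continuum/Support` leaf typed; no `def`, no notation; zero `sorry`.  Imports (BY NAME): the OWNER's (356) `…SupStepKPNormLinear`
(`outputNorm_le_of_uniform`, `outputTouchNorm_le`); the tree's `PolymerGasGeometric.sum_pow_card_le_of_connected`, `Touches`, `GeomInc`, `IsRConnected`,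
`truncatedWeight`; Mathlib's `Complex.norm_exp_sub_one_le`, `Complex.exp_sum`, `Finset.prod_congr`, `Finset.card_insert_le`.

WHAT IS PROVED ([folklore]):
* §1 FROM SUP LETTERS TO THE NORM: **`pinnedNorm_le_of_supLetter`** (`Σ_{Y∈L touching {q}}‖z Y‖e^{a#Y} ≤ (Δ+1)·2εe^{a}` under `hz0`, `hz`, `0 ≤ ε`,
  `(Δ+1)²εe^{a} ≤ 1∕2`);
* §2 THE STEP FROM SUP LETTERS, IN NORM FORM: **`outputNorm_le_of_supLetter`** (`Σ_{Y∈T, p∈Y}‖K⁺(Y)‖e^{τ#Y} ≤ 2(Δ+1)e^{1+τ}ε`) and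
  **`outputTouchNorm_le_of_supLetter`** (`Σ_{Y∈T touching {q}}‖K⁺(Y)‖e^{τ#Y} ≤ (Δ+1)·2(Δ+1)e^{1+τ}ε`) for `L` of nonempty polymers and
  `2(Δ+1)e^{1+τ}ε ≤ 1`, `(Δ+1)²εe^{1+τ} ≤ 1∕2`;
* §3 THE RE-MAYERISATION IN THE SAME NORM: `norm_le_of_touchNorm` (a single support term is `≤ η`), **`touchNorm_expSubOne_le`**
  (`Σ_{Y∈T touching {q}}‖e^{K(Y)} − 1‖e^{a#Y} ≤ 2η`), **`exp_sum_eq_prod_one_add`** (`exp(Σ_{Y∈T}K(Y)) = ∏_{Y∈T}(1 + (e^{K(Y)} − 1))`); §4 toy.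

HONEST (what this is NOT).  Abstract activity level; the factors `f⁺_Y` here are NUMBERS at a fixed external field — as FUNCTIONS of the next
fluctuation field they need sup letters on small fields + the large-field excision (SCOPING-d6 (L3)), and the next step's activity letter needs the
Gaussian integration of their products ((351)'s pattern), neither typed here; the weight shift `1+τ ↦ τ` remains (no rescaling: NC-NE7b-α UNRULED);
scalar skeleton ((A3)); nothing of Bałaban's asserted.  BY-NAME EFFECT ON THE WALL: NONE.  NE7b NOT PRINTED ∕ NOT PROVED; spine PROVED 0∕9; rung (B)+1 —
the programme's measures remain FINITE-torus statements; NOT the mass gap, NOT Clay.  HONEST DEPENDENCY: continuum YM on T⁴ ⇐ BetaPertH ∧ nine spine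
estimates (0∕9 proved); BetaPertH ⇐ (D1) ∧ (D4) ∧ CAP+tail; G-an2-4 gates asym, D1 and NE2∕3∕4.
-/

set_option autoImplicit false

noncomputable section

namespace Summit.QuantumFields.BalabanUV.T4Continuum.NE7b.SupStepReMayer

open Finset Real
open scoped BigOperators
open Literature.Probability.LatticeModels
open SupStepKPNormLinear (outputNorm_le_of_uniform outputTouchNorm_le)

variable {V : Type*} [DecidableEq V] {R : V → V → Prop} [DecidableRel R] {z : Finset V → ℂ} {ε τ a η : ℝ} {nbr : V → Finset V} {Δ : ℕ}

/-! ## §1. From sup letters to the pinned norm -/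

/-- **SUP LETTERS GIVE THE UNIFORM PINNED NORM** (the lattice-animal bound): `R` symmetric with `≤ Δ` neighbours, `z` vanishing off the `R`-connected
sets with `‖z Y‖ ≤ ε^{#Y}`, `0 ≤ ε`, `(Δ+1)²·εe^{a} ≤ 1∕2` (any real weight `a`) ⟹ for every finite family `L` and every cell `q`,
`Σ_{Y∈L touching {q}}‖z Y‖e^{a#Y} ≤ (Δ+1)·2εe^{a}` (a polymer touching `{q}` contains a cell of the closed neighbourhood of `q`; through each cell the
connected sets weigh `≤ 2εe^{a}`). [folklore] -/
theorem pinnedNorm_le_of_supLetter (hR : ∀ x y, R x y → R y x) (hΔ : ∀ x, (nbr x).card ≤ Δ) (hnbr : ∀ x y, R x y → y ∈ nbr x)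
    (hz0 : ∀ Y, ¬ IsRConnected R Y → z Y = 0) (hz : ∀ Y, ‖z Y‖ ≤ ε ^ Y.card) (hε : 0 ≤ ε)
    (hsmall : ((Δ : ℝ) + 1) ^ 2 * (ε * Real.exp a) ≤ 1 / 2) (L : Finset (Finset V)) (q : V) :
    ∑ Y ∈ L with Touches R Y {q}, ‖z Y‖ * Real.exp (a * (Y.card : ℝ)) ≤ ((Δ : ℝ) + 1) * (2 * (ε * Real.exp a)) := by
  classical
  set lam : ℝ := ε * Real.exp a with hlam
  have hlam0 : 0 ≤ lam := by positivity
  set g : Finset V → ℝ := fun Y => ‖z Y‖ * Real.exp (a * (Y.card : ℝ)) with hg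
  have hg0 : ∀ Y, 0 ≤ g Y := fun Y => by positivity
  -- the letter in `λ`-form on connected sets, zero elsewhere
  have hgle : ∀ Y, g Y ≤ (if IsRConnected R Y then lam ^ Y.card else 0) := fun Y => by
    split_ifs with hc
    · calc g Y ≤ ε ^ Y.card * Real.exp (a * (Y.card : ℝ)) := mul_le_mul_of_nonneg_right (hz Y) (exp_pos _).le
        _ = lam ^ Y.card := by rw [hlam, mul_pow, ← Real.exp_nat_mul, mul_comm (Y.card : ℝ)]
    · simp only [hg, hz0 Y hc, norm_zero, zero_mul]; exact le_rfl
  set Nq : Finset V := insert q (nbr q) with hNq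
  -- a polymer touching `{q}` contains a cell of `Nq`
  have hsub : L.filter (fun Y => Touches R Y {q}) ⊆ L.filter (fun Y => ∃ q' ∈ Nq, q' ∈ Y) := fun Y hY => by
    obtain ⟨hYL, w, hw, x, hx, hwx⟩ := mem_filter.1 hY
    rw [mem_singleton] at hx
    subst hx
    refine mem_filter.2 ⟨hYL, ?_⟩
    rcases hwx with rfl | hr
    · exact ⟨w, mem_insert_self _ _, hw⟩
    · exact ⟨w, mem_insert_of_mem (hnbr _ _ (hR _ _ hr)), hw⟩
  calc ∑ Y ∈ L with Touches R Y {q}, g Y ≤ ∑ Y ∈ L with ∃ q' ∈ Nq, q' ∈ Y, g Y := sum_le_sum_of_subset_of_nonneg hsub fun _ _ _ => hg0 _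
    _ ≤ ∑ Y ∈ L with ∃ q' ∈ Nq, q' ∈ Y, ∑ q' ∈ Nq with q' ∈ Y, g Y := by
        refine sum_le_sum fun Y hY => ?_
        obtain ⟨q', hq'N, hq'Y⟩ := (mem_filter.1 hY).2
        have hmem : q' ∈ Nq.filter fun q' => q' ∈ Y := mem_filter.2 ⟨hq'N, hq'Y⟩
        calc g Y = ∑ q'' ∈ ({q'} : Finset V), g Y := by simp
          _ ≤ _ := sum_le_sum_of_subset_of_nonneg (by simpa using hmem) fun _ _ _ => hg0 _
    _ ≤ ∑ Y ∈ L, ∑ q' ∈ Nq with q' ∈ Y, g Y := sum_le_sum_of_subset_of_nonneg (filter_subset _ _) fun _ _ _ => sum_nonneg fun _ _ => hg0 _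
    _ = ∑ q' ∈ Nq, ∑ Y ∈ L with q' ∈ Y, g Y := by
        rw [sum_comm' (t' := Nq) (s' := fun q' => L.filter fun Y => q' ∈ Y)]
        intro Y q'
        simp only [mem_filter]
        tauto
    _ ≤ ∑ q' ∈ Nq, ∑ Y ∈ L with q' ∈ Y, (if IsRConnected R Y then lam ^ Y.card else 0) :=
        sum_le_sum fun q' _ => sum_le_sum fun Y _ => hgle Y
    _ = ∑ q' ∈ Nq, ∑ Y ∈ (L.filter fun Y => q' ∈ Y) with IsRConnected R Y, lam ^ Y.card :=
        sum_congr rfl fun q' _ => (sum_filter _ _).symm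
    _ ≤ ∑ _q' ∈ Nq, 2 * lam := by
        refine sum_le_sum fun q' _ => sum_pow_card_le_of_connected hR hΔ hnbr hlam0 hsmall q' _ fun Y hY => ?_
        obtain ⟨hY', hc⟩ := mem_filter.1 hY
        exact ⟨(mem_filter.1 hY').2, hc⟩
    _ = Nq.card * (2 * lam) := by rw [sum_const, nsmul_eq_mul]
    _ ≤ ((Δ : ℝ) + 1) * (2 * lam) := by
        refine mul_le_mul_of_nonneg_right ?_ (by positivity)
        have h := (card_insert_le q (nbr q)).trans (Nat.add_le_add_right (hΔ q) 1)
        exact_mod_cast h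

/-! ## §2. The step from sup letters, in norm form -/

/-- **THE OUTPUT NORM FROM THE INPUT'S SUP LETTERS**: `R` symmetric with `≤ Δ` neighbours, `z` vanishing off `R`-connected sets with `‖z Y‖ ≤ ε^{#Y}`
on a family `L` of nonempty polymers, `0 ≤ ε`, `0 ≤ τ`, `(Δ+1)²εe^{1+τ} ≤ 1∕2`, `2(Δ+1)e^{1+τ}ε ≤ 1` ⟹ for every index family `T` and cell `p`,
`Σ_{Y∈T, p∈Y}‖K⁺(Y)‖e^{τ#Y} ≤ 2(Δ+1)e^{1+τ}ε`. [folklore] -/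
theorem outputNorm_le_of_supLetter (hR : ∀ x y, R x y → R y x) (hΔ : ∀ x, (nbr x).card ≤ Δ) (hnbr : ∀ x y, R x y → y ∈ nbr x)
    (hz0 : ∀ Y, ¬ IsRConnected R Y → z Y = 0) (hz : ∀ Y, ‖z Y‖ ≤ ε ^ Y.card) (hε : 0 ≤ ε) (hτ : 0 ≤ τ)
    (hsmall : ((Δ : ℝ) + 1) ^ 2 * (ε * Real.exp (1 + τ)) ≤ 1 / 2) (hη : ((Δ : ℝ) + 1) * (2 * (ε * Real.exp (1 + τ))) ≤ 1)
    {L : Finset (Finset V)} (hL : ∀ Y ∈ L, Y.Nonempty) (T : Finset (Finset V)) (p : V) :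
    ∑ Y ∈ T with p ∈ Y, ‖∑ 𝒞 ∈ L.powerset with 𝒞.biUnion id = Y, truncatedWeight (GeomInc R) z 𝒞‖ * Real.exp (τ * Y.card) ≤
      ((Δ : ℝ) + 1) * (2 * (ε * Real.exp (1 + τ))) :=
  outputNorm_le_of_uniform hR hτ hL (fun q => pinnedNorm_le_of_supLetter hR hΔ hnbr hz0 hz hε hsmall L q) hη T p

/-- **THE OUTPUT IN THE INPUT'S NORM FROM SUP LETTERS**: under the same hypotheses, for every cell `q`,
`Σ_{Y∈T touching {q}}‖K⁺(Y)‖e^{τ#Y} ≤ (Δ+1)·2(Δ+1)e^{1+τ}ε`. [folklore] -/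
theorem outputTouchNorm_le_of_supLetter (hR : ∀ x y, R x y → R y x) (hΔ : ∀ x, (nbr x).card ≤ Δ) (hnbr : ∀ x y, R x y → y ∈ nbr x)
    (hz0 : ∀ Y, ¬ IsRConnected R Y → z Y = 0) (hz : ∀ Y, ‖z Y‖ ≤ ε ^ Y.card) (hε : 0 ≤ ε) (hτ : 0 ≤ τ)
    (hsmall : ((Δ : ℝ) + 1) ^ 2 * (ε * Real.exp (1 + τ)) ≤ 1 / 2) (hη : ((Δ : ℝ) + 1) * (2 * (ε * Real.exp (1 + τ))) ≤ 1)
    {L : Finset (Finset V)} (hL : ∀ Y ∈ L, Y.Nonempty) (T : Finset (Finset V)) (q : V) :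
    ∑ Y ∈ T with Touches R Y {q}, ‖∑ 𝒞 ∈ L.powerset with 𝒞.biUnion id = Y, truncatedWeight (GeomInc R) z 𝒞‖ * Real.exp (τ * Y.card) ≤
      ((Δ : ℝ) + 1) * (((Δ : ℝ) + 1) * (2 * (ε * Real.exp (1 + τ)))) :=
  outputTouchNorm_le hR hΔ hnbr hτ hL (fun q => pinnedNorm_le_of_supLetter hR hΔ hnbr hz0 hz hε hsmall L q) hη T q

/-! ## §3. The re-Mayerisation in the same norm -/

/-- **A single support term is at most the norm**: `K` with `Σ_{Y∈T touching {q}}‖K(Y)‖e^{a#Y} ≤ η` for all `q`, `0 ≤ a`, `Y ∈ T` nonempty ⟹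
`‖K(Y)‖ ≤ η` (`Y` touches each of its own cells). [folklore] -/
theorem norm_le_of_touchNorm {K : Finset V → ℂ} (ha : 0 ≤ a) {T : Finset (Finset V)}
    (hN : ∀ q : V, ∑ Y ∈ T with Touches R Y {q}, ‖K Y‖ * Real.exp (a * (Y.card : ℝ)) ≤ η) {Y : Finset V} (hY : Y ∈ T)
    (hne : Y.Nonempty) : ‖K Y‖ ≤ η := by
  obtain ⟨q, hq⟩ := hne
  have hmem : Y ∈ T.filter fun Y' => Touches R Y' {q} := mem_filter.2 ⟨hY, q, hq, q, mem_singleton_self q, Or.inl rfl⟩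
  calc ‖K Y‖ ≤ ‖K Y‖ * Real.exp (a * (Y.card : ℝ)) := le_mul_of_one_le_right (norm_nonneg _) (one_le_exp (by positivity))
    _ ≤ ∑ Y' ∈ T with Touches R Y' {q}, ‖K Y'‖ * Real.exp (a * (Y'.card : ℝ)) :=
        single_le_sum (f := fun Y' => ‖K Y'‖ * Real.exp (a * (Y'.card : ℝ))) (fun _ _ => by positivity) hmem
    _ ≤ η := hN q

/-- **THE NEXT MAYER FACTORS IN THE SAME NORM**: `K` with `Σ_{Y∈T touching {q}}‖K(Y)‖e^{a#Y} ≤ η` for all `q`, `0 ≤ a`, `η ≤ 1`, supports in `T`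
nonempty ⟹ `Σ_{Y∈T touching {q}}‖e^{K(Y)} − 1‖e^{a#Y} ≤ 2η` for all `q` (`‖e^{w} − 1‖ ≤ 2‖w‖` on `‖w‖ ≤ 1`). [folklore] -/
theorem touchNorm_expSubOne_le {K : Finset V → ℂ} (ha : 0 ≤ a) {T : Finset (Finset V)} (hT : ∀ Y ∈ T, Y.Nonempty)
    (hN : ∀ q : V, ∑ Y ∈ T with Touches R Y {q}, ‖K Y‖ * Real.exp (a * (Y.card : ℝ)) ≤ η) (hη : η ≤ 1) (q : V) :
    ∑ Y ∈ T with Touches R Y {q}, ‖Complex.exp (K Y) - 1‖ * Real.exp (a * (Y.card : ℝ)) ≤ 2 * η := by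
  calc ∑ Y ∈ T with Touches R Y {q}, ‖Complex.exp (K Y) - 1‖ * Real.exp (a * (Y.card : ℝ))
      ≤ ∑ Y ∈ T with Touches R Y {q}, 2 * ‖K Y‖ * Real.exp (a * (Y.card : ℝ)) := by
        refine sum_le_sum fun Y hY => mul_le_mul_of_nonneg_right ?_ (exp_pos _).le
        exact Complex.norm_exp_sub_one_le ((norm_le_of_touchNorm ha hN (mem_filter.1 hY).1 (hT Y (mem_filter.1 hY).1)).trans hη)
    _ = 2 * ∑ Y ∈ T with Touches R Y {q}, ‖K Y‖ * Real.exp (a * (Y.card : ℝ)) := by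
        rw [mul_sum]
        exact sum_congr rfl fun Y _ => by ring
    _ ≤ 2 * η := by linarith [hN q]

omit [DecidableEq V] [DecidableRel R] in
/-- **THE OUTPUT IS A MAYER PRODUCT OVER CONNECTED CELL SETS**: `exp(Σ_{Y∈T}K(Y)) = ∏_{Y∈T}(1 + (e^{K(Y)} − 1))`. [folklore] -/
theorem exp_sum_eq_prod_one_add (K : Finset V → ℂ) (T : Finset (Finset V)) :
    Complex.exp (∑ Y ∈ T, K Y) = ∏ Y ∈ T, (1 + (Complex.exp (K Y) - 1)) := by
  rw [Complex.exp_sum]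
  exact prod_congr rfl fun Y _ => by ring

/-! ## §4. Toy -/

omit [DecidableEq V] [DecidableRel R] in
/-- Toy (§3): over the EMPTY family of supports `exp 0 = 1` is the empty Mayer product. -/
example (K : Finset V → ℂ) : Complex.exp (∑ Y ∈ (∅ : Finset (Finset V)), K Y) = ∏ Y ∈ (∅ : Finset (Finset V)), (1 + (Complex.exp (K Y) - 1)) :=
  exp_sum_eq_prod_one_add K ∅

end Summit.QuantumFields.BalabanUV.T4Continuum.NE7b.SupStepReMayer
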